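import Summits.CriticalPhenomena.PercolationContinuityZ3.Theorems.PercNearOneGluingNoHeavyQuantGatedSliceMixLawRegimeBKink1
import Summits.CriticalPhenomena.PercolationContinuityZ3.Theorems.PercNearOneGluingNoHeavyQuantGatedSliceMixLawRegimeBKink2
import HarnessLib

/-!
# QUANT lane R8, T-DEC, leg (III), blob case — `LawDec.GatedSliceMixLaw'` in REGIME B, cell B-G: the polynomial inequality (⋆)
# HOLDS ON THE RESIDUE, so the first kink is unconditional there and CELL B-G IS A THEOREM (Kink2 ∪ Kink1)

builds on p205010 (kernel theorem, internal audit signed; external expert review pending)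

Support file (`--supports stmt-CriticalPhenomena-4575`), QUANT lane seat prim-quant-arm-2 (gen 36), rung R8 of
`run/shared/lean/prim/quant/LADDER.md`; answers lead g32's ask (lane INBOX l.1059, memo
`run/shared/lean/prim/quant/prim-quant-lead-g32/FOR-PROVERS-MIXLAW-KINKS.md` §5–§6: "prove (⋆) on R").  Theorems only, standard axioms,
no sorries, no new definitions.

THE INEQUALITY.  With `t = S + ag(1−z)`, `d = k₁ + a`, lead g32's `…RegimeBKink1` reduces the first-kink certificate of cell B-G
(`h + a ≥ j+1`, `k₂ ≥ j+1`, `d` a `t`-low, `h` a mid, `W_h ∉ D`) to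
**(⋆)  (t − d)·g·(y(h − S) − (1−y)·S·g) ≤ y·(1 − g)·(h − S)·(g·S − k₁)**,
needed only on the residue `R = {k₁ + h ≤ t} ∪ {k₁ + h > t ∧ y(h − k₁) ≤ t − 2k₁ ∧ k₁ < ag(1−z)}` left by `…RegimeBKink2`.

THE PROOF (elementary; no Positivstellensatz certificate is needed).  Put `w := y(h−S) ≥ 0`, `w₀ := (1−y)Sg ≥ 0`, `τ := t − d ≥ 0`,
`A := ag(1−z)`, `V(w) := RHS − LHS`.  Then `V(w) = τg(w₀ − w) + w(1−g)(gS − k₁)` is AFFINE in `w` with slope `−br`,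
`br = g(gS−k₁) + (1−g)(k₁−ag) − ag²z` (lead g32's identity, memo §6), and `gS > k₁` on `R` (from `2d < t`: `A < gS`, and `k₁ < A`).
(i) `w ≤ w₀`: both terms of `V` are `≥ 0`.  (ii) `w > w₀`, `br ≤ 0`: `V(w) ≥ V(w₀) = w₀(1−g)(gS−k₁) ≥ 0`.  (iii) `w > w₀`, `br > 0`: `V` is
decreasing, and `w ≤ min(σ₁, σ₂)` with `σ₁ = S(1−y) − y` (from `y(h+1) ≤ S`, i.e. `k₂ ≥ h+1` and top-affordability) and
`σ₂ = S(1−y) + A − (2−y)k₁` (the dear bound `y(h−k₁) ≤ t − 2k₁`, implied by `k₁ + h ≤ t` on the incompatible part); EXACTLY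
`V(σ₁) = y·g·(gS−k₁) + (σ₁ − w₀)·E`, `V(σ₂) = g(gS−k₁)·((2−y)k₁ − A) + (σ₂ − w₀)·E`, `E := (1−g)(ag − k₁) + ag²z ≥ 0` (as `k₁ < A ≤ ag`),
where `σ − w₀ ≥ w − w₀ > 0` at the binding `σ` and `(2−y)k₁ − A = σ₁ − σ₂ + y ≥ y` when `σ₂` binds.  So `V ≥ 0` on all of `R`; the hypothesis
`W_h ∉ D` is not even used for (⋆) (it is used by the kink certificate itself).  Lead census for comparison: 0 / 2.6·10⁶ (cellB2g/h/i).

* `LawDec.mixLawB_star_of_residue` — (⋆) as a real inequality from `{0 ≤ y ≤ 1, 0 ≤ z, 0 ≤ g ≤ 1, 0 ≤ a, 0 ≤ k, S ≤ h, 2(k+a) ≤ t,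
  k ≤ ag(1−z), y(h+1) ≤ S, y(h−k) ≤ t − 2k}`.
* `LawDec.gatedSliceMixLaw_regimeB_kink1_residue` — `…_kink1` with `hstar` DISCHARGED on the dear-and-small part of the residue
  (`k₁ < ag(1−z)`, `y(h − k₁) ≤ t − 2k₁`); `LawDec.gatedSliceMixLaw_regimeB_kink1_incomp` — the same on the incompatible part (`k₁ + h ≤ t`).
* **`LawDec.gatedSliceMixLaw_regimeB_cellBG`** — the conclusion of `GatedSliceMixLaw'` on the WHOLE cell B-G given `W_h ∉ D`, by cases
  (second kink `…_kink2` | first kink); `LawDec.mixLawRegimeB_of_cellBG` — the same in the binder order of `LawDec.MixLawRegimeB`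
  (`…QuantGatedSliceMixLawCells`) plus the two sub-cell hypotheses `2(k₁ + a) < t`, `j + 1 ≤ k₂`.
So `MixLawRegimeB ∩ {2(k₁+a) < t, k₂ ≥ j+1}` is a kernel theorem; the regime-B cells B-M (`k₂ ≤ j`, census-2 g61: `…RegimeBTop`,
`…RegimeBTwoMid`) and 'ℓ not a `t`-low' remain with their owners.  HONEST STATUS: `GatedSliceMixLaw'`, CW, `SingleGateConvClosed`, `TreeDEC`,
`FarTreeRow` OPEN; RATE class log* / honest sentence unchanged.

[this work]; the reduction to (⋆): lead g32 (`…RegimeBKink1/2`, `…RegimeBTools`); exchange architecture: prim-quant-stmt g30; cell map: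
arm-3 g63–g64, lead g31–g32.  Nothing here is cited as a published result.  The gluing rows served
[cite: KozmaNitzan2024, Conjecture 3 (p. 15)]; product measure [cite: Grimmett1999, §1.3 p. 10].
-/

noncomputable section

namespace Summit.CriticalPhenomena.PercolationContinuityZ3.Theorems

namespace Quant

open Finset

/-- the two-point law `{lo, hi; g}` (as in `…QuantLawDEC`) -/
local notation3 "TP[" lo ", " hi ", " g ", " h "]" =>
  (g : ℝ) * (if (h : ℕ) = (hi : ℕ) then (1 : ℝ) else 0) + (1 - (g : ℝ)) * (if (h : ℕ) = (lo : ℕ) then (1 : ℝ) else 0)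

namespace LawDec

/-! ### (⋆) on the residue — the real inequality -/

/-- **(⋆) ON THE RESIDUE (real form).**  For reals `0 ≤ y ≤ 1`, `0 ≤ z`, `0 ≤ g ≤ 1`, `0 ≤ a`, `0 ≤ k`, `S ≤ h`, with
`t := S + ag(1−z)`: if `2(k + a) ≤ t` (the shifted low), `k ≤ ag(1−z)` (the residue), `y(h+1) ≤ S` (the top `k₂ ≥ h+1` is affordable) and
`y(h − k) ≤ t − 2k` (`k` dear at `h`, or `k + h ≤ t`), then
`(t − k − a)·g·(y(h−S) − (1−y)Sg) ≤ y(1−g)(h−S)(gS − k)`.  Proof: the difference is affine in `w = y(h−S)` with value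
`τg(w₀−w) + w(1−g)(gS−k)` (`w₀ = (1−y)Sg`), nonnegative at `w ≤ w₀`, at `w₀`, and at the binding one of `σ₁ = S(1−y) − y`,
`σ₂ = S(1−y) + ag(1−z) − (2−y)k` by the two sign identities of the file header. [this work] -/
theorem mixLawB_star_of_residue (y z g S a h k : ℝ) (hy0 : 0 ≤ y) (hy1 : y ≤ 1) (hz0 : 0 ≤ z)
    (hg0 : 0 ≤ g) (hg1 : g ≤ 1) (ha0 : 0 ≤ a) (hk0 : 0 ≤ k) (hSh : S ≤ h)
    (hlow : 2 * (k + a) ≤ S + a * g * (1 - z)) (hres : k ≤ a * g * (1 - z))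
    (hσ₁ : y * (h + 1) ≤ S) (hσ₂ : y * (h - k) ≤ S + a * g * (1 - z) - 2 * k) :
    (S + a * g * (1 - z) - k - a) * g * (y * (h - S) - (1 - y) * S * g)
      ≤ y * (1 - g) * (h - S) * (g * S - k) := by
  -- the sign facts of the residue
  have h1g : 0 ≤ 1 - g := by linarith
  have h1y : 0 ≤ 1 - y := by linarith
  have hag : 0 ≤ a * g := mul_nonneg ha0 hg0
  have hgz : g * (1 - z) ≤ 1 := by nlinarith
  have hAag : a * g * (1 - z) ≤ a * g := by nlinarith
  have haga : a * g ≤ a := mul_le_of_le_one_right ha0 hg1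
  have hkag : k ≤ a * g := le_trans hres hAag
  have hE : 0 ≤ (1 - g) * (a * g - k) + a * g * g * z :=
    add_nonneg (mul_nonneg h1g (by linarith)) (mul_nonneg (mul_nonneg hag hg0) hz0)
  have hτ : 0 ≤ S + a * g * (1 - z) - k - a := by linarith
  have hS0 : 0 ≤ S := by linarith
  have hgS : 0 ≤ g * S - k := by
    -- g·S ≥ g·(2k + 2a − A) = 2kg + 2ag − g·A ≥ 2kg + ag ≥ k
    have h1 : g * (2 * (k + a)) ≤ g * (S + a * g * (1 - z)) := mul_le_mul_of_nonneg_left hlow hg0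
    have h2 : g * (a * g * (1 - z)) ≤ a * g := by
      have e : g * (a * g * (1 - z)) = a * g * (g * (1 - z)) := by ring
      rw [e]; exact le_trans (mul_le_mul_of_nonneg_left hgz hag) (le_of_eq (mul_one _))
    have h3 : 0 ≤ k * g := mul_nonneg hk0 hg0
    nlinarith
  have hw : 0 ≤ y * (h - S) := mul_nonneg hy0 (by linarith)
  have hw0 : 0 ≤ (1 - y) * S * g := mul_nonneg (mul_nonneg h1y hS0) hg0
  rw [← sub_nonneg]
  rcases le_or_gt (y * (h - S)) ((1 - y) * S * g) with hww | hww
  · -- (i) w ≤ w₀: both terms nonnegative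
    have key₀ : y * (1 - g) * (h - S) * (g * S - k) - (S + a * g * (1 - z) - k - a) * g * (y * (h - S) - (1 - y) * S * g)
        = (S + a * g * (1 - z) - k - a) * g * ((1 - y) * S * g - y * (h - S)) + y * (h - S) * ((1 - g) * (g * S - k)) := by
      ring
    rw [key₀]
    exact add_nonneg (mul_nonneg (mul_nonneg hτ hg0) (by linarith)) (mul_nonneg hw (mul_nonneg h1g hgS))
  -- w > w₀: V(w) = V(σ) + (σ − w)·br for every σ, br the slope
  rcases le_or_gt (g * (g * S - k) + (1 - g) * (k - a * g) - a * g * g * z) 0 with hbr | hbr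
  · -- (ii) br ≤ 0: compare with σ = w₀
    have key₁ : y * (1 - g) * (h - S) * (g * S - k) - (S + a * g * (1 - z) - k - a) * g * (y * (h - S) - (1 - y) * S * g)
        = (1 - y) * S * g * ((1 - g) * (g * S - k))
          + ((1 - y) * S * g - y * (h - S)) * (g * (g * S - k) + (1 - g) * (k - a * g) - a * g * g * z) := by
      ring
    rw [key₁]
    exact add_nonneg (mul_nonneg hw0 (mul_nonneg h1g hgS)) (mul_nonneg_of_nonpos_of_nonpos (by linarith) hbr)
  -- (iii) br > 0: V decreasing in w, compare with the binding endpoint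
  rcases le_or_gt (S * (1 - y) - y) (S * (1 - y) + a * g * (1 - z) - (2 - y) * k) with hs | hs
  · -- σ₁ binds: V(σ₁) = y g (gS − k) + (σ₁ − w₀)·E
    have key₂ : y * (1 - g) * (h - S) * (g * S - k) - (S + a * g * (1 - z) - k - a) * g * (y * (h - S) - (1 - y) * S * g)
        = (y * g * (g * S - k) + ((S * (1 - y) - y) - (1 - y) * S * g) * ((1 - g) * (a * g - k) + a * g * g * z))
          + ((S * (1 - y) - y) - y * (h - S)) * (g * (g * S - k) + (1 - g) * (k - a * g) - a * g * g * z) := by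
      ring
    have hgap : 0 ≤ (S * (1 - y) - y) - y * (h - S) := by
      have e : (S * (1 - y) - y) - y * (h - S) = S - y * (h + 1) := by ring
      rw [e]; linarith
    rw [key₂]
    refine add_nonneg (add_nonneg (mul_nonneg (mul_nonneg hy0 hg0) hgS) (mul_nonneg (by linarith) hE)) (mul_nonneg hgap hbr.le)
  · -- σ₂ binds: V(σ₂) = g(gS − k)((2−y)k − A) + (σ₂ − w₀)·E, (2−y)k − A = σ₁ − σ₂ + y
    have key₃ : y * (1 - g) * (h - S) * (g * S - k) - (S + a * g * (1 - z) - k - a) * g * (y * (h - S) - (1 - y) * S * g)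
        = (g * (g * S - k) * ((2 - y) * k - a * g * (1 - z))
            + ((S * (1 - y) + a * g * (1 - z) - (2 - y) * k) - (1 - y) * S * g) * ((1 - g) * (a * g - k) + a * g * g * z))
          + ((S * (1 - y) + a * g * (1 - z) - (2 - y) * k) - y * (h - S))
            * (g * (g * S - k) + (1 - g) * (k - a * g) - a * g * g * z) := by
      ring
    have hgap : 0 ≤ (S * (1 - y) + a * g * (1 - z) - (2 - y) * k) - y * (h - S) := by
      have e : (S * (1 - y) + a * g * (1 - z) - (2 - y) * k) - y * (h - S)
          = (S + a * g * (1 - z) - 2 * k) - y * (h - k) := by ring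
      rw [e]; linarith
    have hpos : 0 ≤ (2 - y) * k - a * g * (1 - z) := by linarith
    rw [key₃]
    refine add_nonneg (add_nonneg (mul_nonneg (mul_nonneg hg0 hgS) hpos) (mul_nonneg (by linarith) hE))
      (mul_nonneg hgap hbr.le)

/-! ### Cell B-G: the first kink with (⋆) discharged -/

/-- **`GatedSliceMixLaw'` ON CELL B-G AT THE FIRST KINK — the dear-and-small residue, UNCONDITIONAL.**  Lead g32's
`gatedSliceMixLaw_regimeB_kink1` with its hypothesis (⋆) proved by `mixLawB_star_of_residue`: cell B-G (`h + a ≥ j+1`, `k₂ ≥ j+1`,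
`d = k₁ + a` a `t`-low, `h` a mid), `W_h ∉ D`, `k₁ < ag(1−z)` and `k₁` dear at `h` (`y(h − k₁) ≤ t − 2k₁`). [this work] -/
theorem gatedSliceMixLaw_regimeB_kink1_residue (y z g S lam : ℝ) (a j M h k₁ k₂ : ℕ)
    (hy0 : 0 < y) (hy1 : y < 1) (hz0 : 0 ≤ z) (hz1 : z < 1) (hg1 : g ≤ 1) (hyg : y ≤ (1 - z) * g)
    (hS0 : 0 < S) (hta : y * (M : ℝ) ≤ S) (hhj : h ≤ j) (hhM : h ≤ M) (hSh : S < (h : ℝ))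
    (hW : ¬ DECAtT y (S + (a : ℝ) * g * (1 - z)) j (M + a) (weakMidLaw S g h a))
    (hk : k₁ ≤ k₂) (hk₂M : k₂ ≤ M) (hlam0 : 0 ≤ lam) (hlam1 : lam ≤ 1)
    (hmean : (1 - z) * ((k₁ : ℝ) + ((k₂ : ℝ) - k₁) * lam) = S)
    (hdlow : 2 * ((k₁ + a : ℕ) : ℝ) < S + (a : ℝ) * g * (1 - z)) (hdj : k₁ + a ≤ j) (hk₁j : k₁ ≤ j)
    (hk₂G : j + 1 ≤ k₂) (hhaG : j + 1 ≤ h + a) (hhmid : S + (a : ℝ) * g * (1 - z) ≤ 2 * (h : ℝ))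
    (hres : (k₁ : ℝ) < (a : ℝ) * g * (1 - z))
    (hdear : y * ((h : ℝ) - k₁) ≤ S + (a : ℝ) * g * (1 - z) - 2 * (k₁ : ℝ)) :
    ∃ θ : ℝ, 0 ≤ θ ∧ θ < 1 ∧
      DECAtT y (S + (a : ℝ) * g * (1 - z)) j (M + a)
        (fun p => θ * weakMidLaw S g h a p
          + (1 - θ) * (z * (if p = 0 then (1 : ℝ) else 0) + (1 - z) * slice (fun q => TP[k₁, k₂, lam, q]) a g p)) := by
  have hg0 : 0 < g := by nlinarith
  have hyk₂ : y * (k₂ : ℝ) ≤ S := le_trans (mul_le_mul_of_nonneg_left (by exact_mod_cast hk₂M) hy0.le) hta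
  have hh1 : (h : ℝ) + 1 ≤ (k₂ : ℝ) := by
    have : h + 1 ≤ k₂ := by omega
    exact_mod_cast this
  have hσ₁ : y * ((h : ℝ) + 1) ≤ S := le_trans (mul_le_mul_of_nonneg_left hh1 hy0.le) hyk₂
  have hdcast : ((k₁ + a : ℕ) : ℝ) = (k₁ : ℝ) + a := by push_cast; ring
  have hlow : 2 * ((k₁ : ℝ) + a) ≤ S + (a : ℝ) * g * (1 - z) := by rw [← hdcast]; exact hdlow.le
  have hstar := mixLawB_star_of_residue y z g S a h k₁ hy0.le hy1.le hz0 hg0.le hg1 (Nat.cast_nonneg a)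
    (Nat.cast_nonneg k₁) hSh.le hlow hres.le hσ₁ hdear
  exact gatedSliceMixLaw_regimeB_kink1 y z g S lam a j M h k₁ k₂ hy0 hy1 hz0 hz1 hg1 hyg hS0 hta hhj hhM hSh hW hk hk₂M
    hlam0 hlam1 hmean hdlow hdj hk₁j hk₂G hhaG hhmid hstar

/-- **`GatedSliceMixLaw'` ON CELL B-G AT THE FIRST KINK — the incompatible residue `k₁ + h ≤ t`, UNCONDITIONAL** (there
`k₁ < t − h < t − S = ag(1−z)` and `y(h − k₁) ≤ h − k₁ ≤ t − 2k₁`). [this work] -/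
theorem gatedSliceMixLaw_regimeB_kink1_incomp (y z g S lam : ℝ) (a j M h k₁ k₂ : ℕ)
    (hy0 : 0 < y) (hy1 : y < 1) (hz0 : 0 ≤ z) (hz1 : z < 1) (hg1 : g ≤ 1) (hyg : y ≤ (1 - z) * g)
    (hS0 : 0 < S) (hta : y * (M : ℝ) ≤ S) (hhj : h ≤ j) (hhM : h ≤ M) (hSh : S < (h : ℝ))
    (hW : ¬ DECAtT y (S + (a : ℝ) * g * (1 - z)) j (M + a) (weakMidLaw S g h a))
    (hk : k₁ ≤ k₂) (hk₂M : k₂ ≤ M) (hlam0 : 0 ≤ lam) (hlam1 : lam ≤ 1)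
    (hmean : (1 - z) * ((k₁ : ℝ) + ((k₂ : ℝ) - k₁) * lam) = S)
    (hdlow : 2 * ((k₁ + a : ℕ) : ℝ) < S + (a : ℝ) * g * (1 - z)) (hdj : k₁ + a ≤ j) (hk₁j : k₁ ≤ j)
    (hk₂G : j + 1 ≤ k₂) (hhaG : j + 1 ≤ h + a) (hhmid : S + (a : ℝ) * g * (1 - z) ≤ 2 * (h : ℝ))
    (hincomp : (k₁ : ℝ) + h ≤ S + (a : ℝ) * g * (1 - z)) :
    ∃ θ : ℝ, 0 ≤ θ ∧ θ < 1 ∧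
      DECAtT y (S + (a : ℝ) * g * (1 - z)) j (M + a)
        (fun p => θ * weakMidLaw S g h a p
          + (1 - θ) * (z * (if p = 0 then (1 : ℝ) else 0) + (1 - z) * slice (fun q => TP[k₁, k₂, lam, q]) a g p)) := by
  have hres : (k₁ : ℝ) < (a : ℝ) * g * (1 - z) := by linarith
  have hdcast : ((k₁ + a : ℕ) : ℝ) = (k₁ : ℝ) + a := by push_cast; ring
  have ha0 : (0 : ℝ) ≤ a := Nat.cast_nonneg a
  have hkh : 0 ≤ (h : ℝ) - k₁ := by rw [hdcast] at hdlow; linarith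
  have hdear : y * ((h : ℝ) - k₁) ≤ S + (a : ℝ) * g * (1 - z) - 2 * (k₁ : ℝ) :=
    le_trans (mul_le_of_le_one_left hkh hy1.le) (by linarith)
  exact gatedSliceMixLaw_regimeB_kink1_residue y z g S lam a j M h k₁ k₂ hy0 hy1 hz0 hz1 hg1 hyg hS0 hta hhj hhM hSh hW hk
    hk₂M hlam0 hlam1 hmean hdlow hdj hk₁j hk₂G hhaG hhmid hres hdear

/-! ### Cell B-G is a theorem -/

set_option maxHeartbeats 400000 in
/-- **`GatedSliceMixLaw'` ON THE WHOLE CELL B-G** — regime B (`h + a ≥ j+1`), `k₂ ≥ j+1`, `d = k₁ + a` a `t`-low (`d ≤ j`), `h` a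
mid (`S < h`, `t ≤ 2h`), `W_h ∉ D`: the conclusion of `GatedSliceMixLaw'`.  By cases: `t < k₁ + h` with [`k₁` light at `h` OR
`k₁ ≥ ag(1−z)`] → the second kink (`…_kink2`, with `g < 1` from `W_h ∉ D` by `decAtT_weakMidLaw_of_giant`); otherwise the first kink
(`…_kink1_residue` / `…_kink1_incomp`). [this work] -/
theorem gatedSliceMixLaw_regimeB_cellBG (y z g S lam : ℝ) (a j M h k₁ k₂ : ℕ)
    (hy0 : 0 < y) (hy1 : y < 1) (hz0 : 0 ≤ z) (hz1 : z < 1) (hg1 : g ≤ 1) (hyg : y ≤ (1 - z) * g)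
    (hS0 : 0 < S) (hta : y * (M : ℝ) ≤ S) (hhj : h ≤ j) (hhM : h ≤ M) (hSh : S < (h : ℝ))
    (hW : ¬ DECAtT y (S + (a : ℝ) * g * (1 - z)) j (M + a) (weakMidLaw S g h a))
    (hk : k₁ ≤ k₂) (hk₂M : k₂ ≤ M) (hlam0 : 0 ≤ lam) (hlam1 : lam ≤ 1)
    (hmean : (1 - z) * ((k₁ : ℝ) + ((k₂ : ℝ) - k₁) * lam) = S)
    (hdlow : 2 * ((k₁ + a : ℕ) : ℝ) < S + (a : ℝ) * g * (1 - z)) (hdj : k₁ + a ≤ j)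
    (hk₂G : j + 1 ≤ k₂) (hhaG : j + 1 ≤ h + a) (hhmid : S + (a : ℝ) * g * (1 - z) ≤ 2 * (h : ℝ)) :
    ∃ θ : ℝ, 0 ≤ θ ∧ θ < 1 ∧
      DECAtT y (S + (a : ℝ) * g * (1 - z)) j (M + a)
        (fun p => θ * weakMidLaw S g h a p
          + (1 - θ) * (z * (if p = 0 then (1 : ℝ) else 0) + (1 - z) * slice (fun q => TP[k₁, k₂, lam, q]) a g p)) := by
  classical
  have hk₁j : k₁ ≤ j := by omega
  -- `g < 1` from `W_h ∉ D` (at `g = 1` the giant covers the zero)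
  have h1y : 0 < 1 - y := by linarith
  have hg0 : 0 < g := by nlinarith
  have hh0 : (0 : ℝ) < h := lt_trans hS0 hSh
  have hyh : y * (h : ℝ) ≤ S := le_trans (mul_le_mul_of_nonneg_left (by exact_mod_cast hhM) hy0.le) hta
  have hXw : ¬ (y / (1 - y) * (1 - S / h) ≤ S / h * g) := fun hcov =>
    hW (decAtT_weakMidLaw_of_giant y z g S a j M h hy0 hy1 hg0.le hg1 hS0.le hSh hhj hhM hhaG hhmid hcov)
  have hg1' : g < 1 := by
    by_contra hge
    have hgeq : g = 1 := le_antisymm hg1 (not_lt.1 hge)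
    apply hXw
    rw [hgeq, mul_one, div_mul_eq_mul_div, div_le_iff₀ h1y]
    have hys : y ≤ S / h := by rw [le_div_iff₀ hh0]; exact hyh
    nlinarith
  by_cases hK2 : S + (a : ℝ) * g * (1 - z) < (k₁ : ℝ) + h ∧
      (S + (a : ℝ) * g * (1 - z) - 2 * (k₁ : ℝ) < y * ((h : ℝ) - k₁) ∨ S + (a : ℝ) * g * (1 - z) - S ≤ (k₁ : ℝ))
  · exact gatedSliceMixLaw_regimeB_kink2 y z g S lam a j M h k₁ k₂ hy0 hy1 hz0 hz1 hg1' hyg hS0 hta hhj hhM hSh hk hk₂M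
      hlam0 hlam1 hmean hdlow hdj hk₂G hhaG hhmid hK2.1 hK2.2
  · by_cases hcomp : S + (a : ℝ) * g * (1 - z) < (k₁ : ℝ) + h
    · have hno : ¬ (S + (a : ℝ) * g * (1 - z) - 2 * (k₁ : ℝ) < y * ((h : ℝ) - k₁) ∨
          S + (a : ℝ) * g * (1 - z) - S ≤ (k₁ : ℝ)) := fun h' => hK2 ⟨hcomp, h'⟩
      obtain ⟨hno₁, hno₂⟩ := not_or.mp hno
      have hdear : y * ((h : ℝ) - k₁) ≤ S + (a : ℝ) * g * (1 - z) - 2 * (k₁ : ℝ) := not_lt.mp hno₁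
      have hsmall : (k₁ : ℝ) < S + (a : ℝ) * g * (1 - z) - S := not_le.mp hno₂
      have hres : (k₁ : ℝ) < (a : ℝ) * g * (1 - z) := by linarith
      exact gatedSliceMixLaw_regimeB_kink1_residue y z g S lam a j M h k₁ k₂ hy0 hy1 hz0 hz1 hg1 hyg hS0 hta hhj hhM hSh
        hW hk hk₂M hlam0 hlam1 hmean hdlow hdj hk₁j hk₂G hhaG hhmid hres hdear
    · exact gatedSliceMixLaw_regimeB_kink1_incomp y z g S lam a j M h k₁ k₂ hy0 hy1 hz0 hz1 hg1 hyg hS0 hta hhj hhM hSh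
        hW hk hk₂M hlam0 hlam1 hmean hdlow hdj hk₁j hk₂G hhaG hhmid (not_lt.1 hcomp)

/-- **`MixLawRegimeB` ON ITS SUB-CELL B-G** — the binder of `LawDec.MixLawRegimeB` (`…QuantGatedSliceMixLawCells`) verbatim, plus the
two sub-cell hypotheses `2(k₁ + a) < t` (the shifted low `ℓ` is a `t`-low) and `j + 1 ≤ k₂` (the top is a giant): the conclusion holds
(`gatedSliceMixLaw_regimeB_cellBG`; `t ≤ 2S < 2h` makes `h` a mid). [this work] -/
theorem mixLawRegimeB_of_cellBG (y z g S lam : ℝ) (a j M h k₁ k₂ : ℕ)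
    (hy0 : 0 < y) (hy1 : y < 1) (hz0 : 0 ≤ z) (hz1 : z < 1) (hg1 : g ≤ 1) (hyg : y ≤ (1 - z) * g) (_ha1 : 1 ≤ a)
    (_hjM : j < M + a) (hS0 : 0 < S) (hta : y * (M : ℝ) ≤ S) (hhj : h ≤ j) (hhM : h ≤ M) (hSh : S < (h : ℝ))
    (hW : ¬ DECAtT y (S + (a : ℝ) * g * (1 - z)) j (M + a) (weakMidLaw S g h a))
    (hk : k₁ ≤ k₂) (hk₂M : k₂ ≤ M) (hlam0 : 0 ≤ lam) (hlam1 : lam ≤ 1)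
    (hmean : (1 - z) * ((k₁ : ℝ) + ((k₂ : ℝ) - k₁) * lam) = S)
    (_hk₁j : k₁ ≤ j) (_hk₁low : 2 * (k₁ : ℝ) < S + (a : ℝ) * g * (1 - z)) (hdj : k₁ + a ≤ j) (_hk₂aG : j + 1 ≤ k₂ + a)
    (htS : S + (a : ℝ) * g * (1 - z) ≤ 2 * S) (hhaG : j + 1 ≤ h + a)
    (hdlow : 2 * ((k₁ + a : ℕ) : ℝ) < S + (a : ℝ) * g * (1 - z)) (hk₂G : j + 1 ≤ k₂) :
    ∃ θ : ℝ, 0 ≤ θ ∧ θ < 1 ∧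
      DECAtT y (S + (a : ℝ) * g * (1 - z)) j (M + a)
        (fun p => θ * weakMidLaw S g h a p
          + (1 - θ) * (z * (if p = 0 then (1 : ℝ) else 0) + (1 - z) * slice (fun q => TP[k₁, k₂, lam, q]) a g p)) :=
  gatedSliceMixLaw_regimeB_cellBG y z g S lam a j M h k₁ k₂ hy0 hy1 hz0 hz1 hg1 hyg hS0 hta hhj hhM hSh hW hk hk₂M hlam0 hlam1
    hmean hdlow hdj hk₂G hhaG (by linarith)

end LawDec

end Quant

end Summit.CriticalPhenomena.PercolationContinuityZ3.Theorems
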